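import Literature.Analysis.FluidPDE.Ferrari1993LogEstimateReduction
import Literature.Analysis.FunctionSpaces.ConvexLipschitzDomain
import Literature.Analysis.FunctionSpaces.SobolevSupBoundDomain
import Literature.Analysis.FunctionSpaces.SobolevTraceEmbeddingProofs
import HarnessLib

/-!
# Sobolev inequalities on the period cell of the periodic cylinder

Topic `Literature/Analysis/FluidPDE`. Infrastructure for the named facts of the Euler blow-up
programme in the axially periodic cylinder `{r ≤ 1} × ℝ/Lℤ` — the `H^s` energy inequality
`Ferrari1993_periodicCylinderHsEnergyInequality`, the logarithmic estimate
`ShirotaYanagisawa1993_periodicCylinderLogEstimate` (`Ferrari1993H3Bound.lean`), the uniform-time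
existence `KatoLai1984_periodicCylinderUniformExistence` (`Ferrari1993Continuation.lean`) — all of
which are stated with the tree's Sobolev norms `eSobolevDomainNorm k p (cylinderCell L) volume` on
the open period cell `cylinderCell L = {r < 1} × (0, L)` and whose printed proofs (Ferrari 1993,
Lemmas 1–2 and §2; Kato–Lai 1984, §4; Shirota–Yanagisawa 1993) use the Sobolev imbedding
theorem on the spatial domain throughout (e.g. Kato–Lai, p. 19: "`H^{s-1} ⊂ L^∞` since
`s - 1 > m/2`"; Ferrari, p. 282: the bound (17) "and Sobolev's theorem"). This file makes the
tree's Sobolev theory on bounded Lipschitz domains available on the cell and records the three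
inequalities used:

* `isLipschitzDomain_cylinderCell` — the cell is a bounded convex open set, hence a Lipschitz
  domain (`isLipschitzDomain_of_convex`); with it, `stein_extension_holds`,
  `exists_eLpNorm_le_of_memSobolevDomain_one`, the trace and density theorems of
  `FunctionSpaces/SobolevTrace*` all apply to `cylinderCell L`;
* `cylinderCell_eLpNorm_six_le` — `H¹(cell) ⊂ L⁶(cell)`:
  `‖f‖_{L⁶(cell)} ≤ C ‖f‖_{W^{1,2}(cell)}` (Adams 1975, Thm. 5.4 Part I Case A (4), `n = 3`,
  `m = 1`, `p = 2`, `q = 6`; tree: `exists_eLpNorm_le_of_memSobolevDomain_one`);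
* `cylinderCell_enorm_le_eSobolevDomainNorm_two` — `H²(cell) ⊂ C_B(cell)`:
  `‖f(x)‖ ≤ K ‖f‖_{W^{2,2}(cell)}` on the cell for `f ∈ W^{2,2}(cell)` continuous on the cell
  (Adams 1975, Thm. 5.4 Part I Case C (8); tree: `exists_forall_enorm_le_eSobolevDomainNorm_two`);
* `cylinderCell_eSobolevDomainNorm_one_top_le` — `H³(cell) ⊂ W^{1,∞}(cell)`:
  `‖f‖_{W^{1,∞}(cell)} ≤ K ‖f‖_{W^{3,2}(cell)}` for `f` smooth on the cell (the previous item
  applied to `f` and to its first derivatives; Adams 1975, Thm. 5.4 Part I Case C (8) with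
  `j = 1`, Remark 5.5 (5)).

No periodicity or symmetry enters: these are statements about one bounded convex cell. All
constants depend only on `L`.

## Mathlib / tree search

`lean search 'isLipschitzDomain_|cylinderCell'`: the cell's geometry so far consists of
`norm_le_of_mem_cylinderCell`, `isCompact_closure_cylinderCell`,
`eSobolevDomainNorm_cylinderCell_lt_top` (`KatoLaiUniformExistenceBridge.lean`), `convex_cylinderCell`,
`volume_cylinderCell_lt_top` (`Ferrari1993LogEstimateReduction.lean`); Lipschitz
domains known to the tree: balls, `C^k` domains, bounded convex open sets (`ConvexLipschitzDomain.lean`). Used: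
`MeyersSerrin.eSobolevDomainNorm_succ_eq`, `MeyersSerrin.hasWeakFDerivOn_of_contDiffOn`,
`eSobolevDomainNorm_lt_top_iff_holds`, `eSobolevDomainNorm_le_succ`,
`eLpNorm_le_mul_sum_eLpNorm_apply_basis`; Mathlib `finrank_euclideanSpace_fin`,
`contDiffOn_infty_iff_fderiv_of_isOpen`, `eLpNormEssSup_le_of_ae_enorm_bound`.

## References

* R. A. Adams, *Sobolev Spaces*, Academic Press (1975), Thm. 5.4 Part I (p. 89 of the held
  text), Remark 5.5 (5) (p. 90), Lemma 5.15 (pp. 97–98). [Adams1975]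
* T. Kato, C. Y. Lai, *Nonlinear evolution equations and the Euler flow*, J. Funct. Anal. 56
  (1984) 15–28, §4 p. 19 (use of the imbedding theorem on `Ω`). [KatoLai1984]
* A. B. Ferrari, *On the blow-up of solutions of the 3-D Euler equations in a bounded domain*,
  Comm. Math. Phys. 155 (1993) 277–294, Lemma 1 p. 280 and p. 282. [Ferrari1993]
-/

noncomputable section

open MeasureTheory Set Function Filter Topology TopologicalSpace WithLp Metric Module
open scoped ContDiff NNReal ENNReal InnerProductSpace RealInnerProductSpace

namespace Literature.Analysis.FluidPDE

open Literature.Analysis.FunctionSpaces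

/-! ### The cell is a bounded convex Lipschitz domain -/

/-- The period cell is bounded (its closure is compact). [folklore] -/
theorem isBounded_cylinderCell (L : ℝ) :
    Bornology.IsBounded (cylinderCell L : Set (EuclideanSpace ℝ (Fin 3))) :=
  (isCompact_closure_cylinderCell L).isBounded.subset subset_closure

/-- **The period cell `{r < 1} × (0, L)` is a Lipschitz domain** (a bounded convex open set:
`isLipschitzDomain_of_convex`, Agranovich 2015, Cor. 9.1.2), so that the tree's Sobolev theory
on bounded Lipschitz domains — Stein extension, Sobolev and trace inequalities, density of
`C^∞(Ω̄)` — applies to it. [cite: Agranovich2015, §9.1 Cor. 9.1.2 (p. 141)] -/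
theorem isLipschitzDomain_cylinderCell (L : ℝ) : IsLipschitzDomain (cylinderCell L) :=
  isLipschitzDomain_of_convex (convex_cylinderCell L) (isBounded_cylinderCell L)

/-! ### `H¹(cell) ⊂ L⁶(cell)` -/

section Embeddings

variable {F : Type*} [NormedAddCommGroup F] [NormedSpace ℝ F]

/-- **`H¹ ⊂ L⁶` on the period cell** (Adams, *Sobolev Spaces* (1975), Thm. 5.4 Part I Case A,
imbedding (4): `W^{m,p}(Ω) → L^q(Ω)`, `p ≤ q ≤ np/(n - mp)`, for `Ω` with the cone property;
here `n = 3`, `m = 1`, `p = 2`, `q = 6`, proved in the tree for bounded Lipschitz domains as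
`exists_eLpNorm_le_of_memSobolevDomain_one`): there is `C` with
`‖f‖_{L⁶(cell)} ≤ C (‖f‖_{L²(cell)} + ‖Df‖_{L²(cell)})` for every `f ∈ W^{1,2}(cell; F)` with
weak derivative `Df = g` (`F` complete). [cite: Adams1975, Thm. 5.4 Part I Case A (4) (p. 89), Lemma 5.10] -/
theorem cylinderCell_eLpNorm_six_le_add [CompleteSpace F] (L : ℝ) :
    ∃ C : ℝ≥0, ∀ (f : EuclideanSpace ℝ (Fin 3) → F)
      (g : EuclideanSpace ℝ (Fin 3) → EuclideanSpace ℝ (Fin 3) →L[ℝ] F),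
      MemSobolevDomain 1 2 (cylinderCell L) volume f →
      HasWeakFDerivOn (cylinderCell L) volume f g →
      eLpNorm f 6 (volume.restrict (cylinderCell L : Set _)) ≤
        C * (eLpNorm f 2 (volume.restrict (cylinderCell L : Set _)) +
          eLpNorm g 2 (volume.restrict (cylinderCell L : Set _))) := by
  have h := exists_eLpNorm_le_of_memSobolevDomain_one (F := F)
    (isLipschitzDomain_cylinderCell L) (isBounded_cylinderCell L) (p := 2) (p' := 6)
    one_le_two (by rw [finrank_euclideanSpace_fin]; norm_num)
    (by rw [finrank_euclideanSpace_fin]; norm_num) volume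
  obtain ⟨C, hC⟩ := h
  exact ⟨C, fun f g hf hg => by exact_mod_cast hC f g (by exact_mod_cast hf) hg⟩

/-- **`H¹ ⊂ L⁶` on the period cell, in the tree's Sobolev norm**:
`‖f‖_{L⁶(cell)} ≤ C ‖f‖_{W^{1,2}(cell)}` for every `f ∈ W^{1,2}(cell; F)` (`F` complete), the
right-hand side being the sum-form norm `‖f‖_{L²} + Σᵢ ‖∂ᵢ f‖_{L²}`, which controls `‖Df‖_{L²}`
(`eLpNorm_le_mul_sum_eLpNorm_apply_basis`). (Adams 1975, Thm. 5.4 Part I Case A (4).)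
[cite: Adams1975, Thm. 5.4 Part I Case A (4) (p. 89)] -/
theorem cylinderCell_eLpNorm_six_le [CompleteSpace F] (L : ℝ) :
    ∃ C : ℝ≥0, ∀ f : EuclideanSpace ℝ (Fin 3) → F,
      MemSobolevDomain 1 2 (cylinderCell L) volume f →
      eLpNorm f 6 (volume.restrict (cylinderCell L : Set _)) ≤
        C * eSobolevDomainNorm 1 2 (cylinderCell L) volume f := by
  obtain ⟨C, hC⟩ := cylinderCell_eLpNorm_six_le_add (F := F) L
  obtain ⟨C₁, -, hC₁⟩ :=
    exists_opNorm_le_mul_sum_basis (F := F) (finBasis ℝ (EuclideanSpace ℝ (Fin 3)))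
  refine ⟨C * (1 + C₁), fun f hf => ?_⟩
  set ν : Measure (EuclideanSpace ℝ (Fin 3)) := volume.restrict (cylinderCell L : Set _) with hν
  obtain ⟨hf0, g, hg, hgk⟩ := hf
  set D : Fin (finrank ℝ (EuclideanSpace ℝ (Fin 3))) → EuclideanSpace ℝ (Fin 3) → F :=
    fun i x => g x (finBasis ℝ _ i) with hD
  have hnorm : eSobolevDomainNorm 1 2 (cylinderCell L) volume f =
      eLpNorm f 2 ν + ∑ i, eLpNorm (D i) 2 ν := by
    rw [MeyersSerrin.eSobolevDomainNorm_succ_eq hg]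
    simp only [eSobolevDomainNorm_zero, hν, hD]
  have hgL2 : eLpNorm g 2 ν ≤ C₁ * ∑ i, eLpNorm (D i) 2 ν :=
    eLpNorm_le_mul_sum_eLpNorm_apply_basis (finBasis ℝ _) hC₁
      hg.locallyIntegrableOn_deriv.aestronglyMeasurable one_le_two
  calc eLpNorm f 6 ν
      ≤ C * (eLpNorm f 2 ν + eLpNorm g 2 ν) := hC f g ⟨hf0, g, hg, hgk⟩ hg
    _ ≤ C * ((1 + C₁) * eLpNorm f 2 ν + (1 + C₁) * ∑ i, eLpNorm (D i) 2 ν) := by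
        gcongr
        · calc eLpNorm f 2 ν = 1 * eLpNorm f 2 ν := (one_mul _).symm
            _ ≤ _ := by gcongr; exact le_self_add
        · exact hgL2.trans (by gcongr; exact le_add_self)
    _ = C * (1 + C₁) * eSobolevDomainNorm 1 2 (cylinderCell L) volume f := by
        rw [hnorm]; ring

end Embeddings

/-! ### `H²(cell) ⊂ C_B(cell)` and `H³(cell) ⊂ W^{1,∞}(cell)` -/

section SupBounds

variable {F : Type*} [NormedAddCommGroup F] [NormedSpace ℝ F] [FiniteDimensional ℝ F]

/-- **`H² ⊂ C_B` on the period cell** (Adams, *Sobolev Spaces* (1975), Thm. 5.4 Part I Case C,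
imbedding (8): `W^{j+m,p}(Ω) → C_B^j(Ω)` for `mp > n`; here `m = p = 2`, `n = 3`, `j = 0`, on
the bounded Lipschitz domain `cylinderCell L`, the tree's
`exists_forall_enorm_le_eSobolevDomainNorm_two`): there is `K` with
`‖f(x)‖ ≤ K ‖f‖_{W^{2,2}(cell)}` for all `x` in the cell, for every `f ∈ W^{2,2}(cell; F)`
continuous on the cell (`F` finite-dimensional). [cite: Adams1975, Thm. 5.4 Part I Case C (8) (p. 89) with Remark 5.5 (4) and Lemma 5.15] -/
theorem cylinderCell_enorm_le_eSobolevDomainNorm_two (L : ℝ) :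
    ∃ K : ℝ≥0, ∀ f : EuclideanSpace ℝ (Fin 3) → F,
      MemSobolevDomain 2 2 (cylinderCell L) volume f →
      ContinuousOn f (cylinderCell L : Set _) →
      ∀ x ∈ (cylinderCell L : Set _),
        ‖f x‖ₑ ≤ K * eSobolevDomainNorm 2 2 (cylinderCell L) volume f := by
  obtain ⟨K, hK, h⟩ := exists_forall_enorm_le_eSobolevDomainNorm_two
    (volume : Measure (EuclideanSpace ℝ (Fin 3))) (F := F) finrank_euclideanSpace_fin
    (isLipschitzDomain_cylinderCell L) (isBounded_cylinderCell L)
  refine ⟨K.toNNReal, fun f hf hfc x hx => ?_⟩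
  rw [ENNReal.coe_toNNReal hK.ne]
  exact h f hf hfc x hx

/-- The `L^∞(cell)` form of `cylinderCell_enorm_le_eSobolevDomainNorm_two`:
`‖f‖_{L^∞(cell)} ≤ K ‖f‖_{W^{2,2}(cell)}` for `f ∈ W^{2,2}(cell; F)` continuous on the cell.
[cite: Adams1975, Thm. 5.4 Part I Case C (8) (p. 89)] -/
theorem cylinderCell_eLpNorm_top_le_eSobolevDomainNorm_two (L : ℝ) :
    ∃ K : ℝ≥0, ∀ f : EuclideanSpace ℝ (Fin 3) → F,
      MemSobolevDomain 2 2 (cylinderCell L) volume f →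
      ContinuousOn f (cylinderCell L : Set _) →
      eLpNorm f ∞ (volume.restrict (cylinderCell L : Set _)) ≤
        K * eSobolevDomainNorm 2 2 (cylinderCell L) volume f := by
  obtain ⟨K, h⟩ := cylinderCell_enorm_le_eSobolevDomainNorm_two (F := F) L
  refine ⟨K, fun f hf hfc => ?_⟩
  rw [eLpNorm_exponent_top]
  exact eLpNormEssSup_le_of_ae_enorm_bound
    (ae_restrict_of_forall_mem (cylinderCell L).isOpen.measurableSet (h f hf hfc))

/-- Membership in `W^{k,p}(cell)` from a finite norm, for functions continuous on the cell.
[folklore] -/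
theorem memSobolevDomain_cylinderCell_of_lt_top {k : ℕ} {p : ℝ≥0∞} {L : ℝ}
    {f : EuclideanSpace ℝ (Fin 3) → F} (hfc : ContinuousOn f (cylinderCell L : Set _))
    (h : eSobolevDomainNorm k p (cylinderCell L) volume f < ⊤) :
    MemSobolevDomain k p (cylinderCell L) volume f :=
  (eSobolevDomainNorm_lt_top_iff_holds
    (hfc.aestronglyMeasurable (cylinderCell L).isOpen.measurableSet)).1 h

/-- **`H³ ⊂ W^{1,∞}` on the period cell** (Adams, *Sobolev Spaces* (1975), Thm. 5.4 Part I
Case C, imbedding (8) with `j = 1`, `m = p = 2`, `n = 3`: `W^{3,2}(Ω) → C_B^1(Ω)`, reduced to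
`j = 0` as in Remark 5.5 (5) by applying the `C_B^0` bound to `f` and to each `∂ᵢ f`): there is
`K` with `‖f‖_{W^{1,∞}(cell)} ≤ K ‖f‖_{W^{3,2}(cell)}` (tree norms, sum form) for every `f` smooth
on the open cell — in particular for every slice of the smooth Euler classes
`IsPeriodicCylinderEulerSolution` / `IsCylinderEulerSolution`, which are `C^∞` on the closed
cylinder. If `‖f‖_{W^{3,2}(cell)} = ∞` the bound is trivial; otherwise `f ∈ W^{3,2}(cell)`, the
infima in both norms are attained at the classical derivative
(`MeyersSerrin.eSobolevDomainNorm_succ_eq`), and `‖f‖_{L^∞} ≤ K₀ ‖f‖_{W^{2,2}} ≤ K₀ ‖f‖_{W^{3,2}}`,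
`‖∂ᵢf‖_{L^∞} ≤ K₀ ‖∂ᵢf‖_{W^{2,2}}` with `Σᵢ ‖∂ᵢ f‖_{W^{2,2}} ≤ ‖f‖_{W^{3,2}}`. [cite: Adams1975, Thm. 5.4 Part I Case C (8) (p. 89) and Remark 5.5 (5) (p. 90)] -/
theorem cylinderCell_eSobolevDomainNorm_one_top_le (L : ℝ) :
    ∃ K : ℝ≥0, ∀ f : EuclideanSpace ℝ (Fin 3) → F,
      ContDiffOn ℝ ∞ f (cylinderCell L : Set _) →
      eSobolevDomainNorm 1 ∞ (cylinderCell L) volume f ≤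
        K * eSobolevDomainNorm 3 2 (cylinderCell L) volume f := by
  obtain ⟨K₀, h₀⟩ := cylinderCell_eLpNorm_top_le_eSobolevDomainNorm_two (F := F) L
  refine ⟨2 * K₀ + 1, fun f hf => ?_⟩
  set Ω := cylinderCell L with hΩ
  set ν : Measure (EuclideanSpace ℝ (Fin 3)) := volume.restrict (Ω : Set _) with hν
  by_cases htop : eSobolevDomainNorm 3 2 Ω volume f = ⊤
  · rw [htop, ENNReal.mul_top (by exact_mod_cast (by positivity : (2 * K₀ + 1 : ℝ≥0) ≠ 0))]
    exact le_top
  -- the classical derivative and its components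
  have hW : HasWeakFDerivOn Ω volume f (fderiv ℝ f) :=
    MeyersSerrin.hasWeakFDerivOn_of_contDiffOn hf
  have hD : ContDiffOn ℝ ∞ (fun y => fderiv ℝ f y) (Ω : Set _) :=
    ((contDiffOn_infty_iff_fderiv_of_isOpen Ω.isOpen).1 hf).2
  set D : Fin (finrank ℝ (EuclideanSpace ℝ (Fin 3))) → EuclideanSpace ℝ (Fin 3) → F :=
    fun i x => fderiv ℝ f x (finBasis ℝ _ i) with hDdef
  have hDi : ∀ i, ContDiffOn ℝ ∞ (D i) (Ω : Set _) := fun i =>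
    hD.clm_apply contDiffOn_const
  -- the two norms unfolded at the classical derivative
  have h3 : eSobolevDomainNorm 3 2 Ω volume f =
      eLpNorm f 2 ν + ∑ i, eSobolevDomainNorm 2 2 Ω volume (D i) :=
    MeyersSerrin.eSobolevDomainNorm_succ_eq hW
  have h1 : eSobolevDomainNorm 1 ∞ Ω volume f = eLpNorm f ∞ ν + ∑ i, eLpNorm (D i) ∞ ν := by
    rw [MeyersSerrin.eSobolevDomainNorm_succ_eq hW]
    simp only [eSobolevDomainNorm_zero, hν, hDdef]
  -- finiteness and membership
  have hlt : eSobolevDomainNorm 3 2 Ω volume f < ⊤ := lt_top_iff_ne_top.2 htop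
  have h2le3 : eSobolevDomainNorm 2 2 Ω volume f ≤ eSobolevDomainNorm 3 2 Ω volume f :=
    eSobolevDomainNorm_le_succ
  have hsum_le : ∑ i, eSobolevDomainNorm 2 2 Ω volume (D i) ≤ eSobolevDomainNorm 3 2 Ω volume f := by
    rw [h3]; exact le_add_self
  have hmem_f : MemSobolevDomain 2 2 Ω volume f :=
    memSobolevDomain_cylinderCell_of_lt_top hf.continuousOn (h2le3.trans_lt hlt)
  have hmem_i : ∀ i, MemSobolevDomain 2 2 Ω volume (D i) := fun i =>
    memSobolevDomain_cylinderCell_of_lt_top (hDi i).continuousOn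
      ((Finset.single_le_sum (f := fun j => eSobolevDomainNorm 2 2 Ω volume (D j))
        (fun _ _ => zero_le) (Finset.mem_univ i)).trans_lt (hsum_le.trans_lt hlt))
  -- the sup bounds
  have hfinf : eLpNorm f ∞ ν ≤ K₀ * eSobolevDomainNorm 3 2 Ω volume f :=
    (h₀ f hmem_f hf.continuousOn).trans (by gcongr)
  have hiinf : ∀ i, eLpNorm (D i) ∞ ν ≤ K₀ * eSobolevDomainNorm 2 2 Ω volume (D i) := fun i =>
    h₀ _ (hmem_i i) (hDi i).continuousOn
  rw [h1]
  calc eLpNorm f ∞ ν + ∑ i, eLpNorm (D i) ∞ ν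
      ≤ K₀ * eSobolevDomainNorm 3 2 Ω volume f +
          ∑ i, K₀ * eSobolevDomainNorm 2 2 Ω volume (D i) :=
        add_le_add hfinf (Finset.sum_le_sum fun i _ => hiinf i)
    _ ≤ K₀ * eSobolevDomainNorm 3 2 Ω volume f + K₀ * eSobolevDomainNorm 3 2 Ω volume f := by
        rw [← Finset.mul_sum]
        gcongr
    _ = (2 * K₀) * eSobolevDomainNorm 3 2 Ω volume f := by ring
    _ ≤ (2 * K₀ + 1 : ℝ≥0) * eSobolevDomainNorm 3 2 Ω volume f := by
        gcongr
        push_cast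
        exact le_self_add

/-- **`H³ ⊂ W^{1,∞}` on the period cell for fields smooth on the closed cylinder** — the form
consumed by the smooth Euler classes (`IsPeriodicCylinderEulerSolution.smooth_velocity` gives
slices `C^∞` on `closure {r < 1} ⊇ cell`): `‖φ‖_{W^{1,∞}(cell)} ≤ K ‖φ‖_{W^{3,2}(cell)}`, both
sides finite (`eSobolevDomainNorm_cylinderCell_lt_top`). [cite: Adams1975, Thm. 5.4 Part I Case C (8) (p. 89)] -/
theorem cylinderCell_eSobolevDomainNorm_one_top_le_of_contDiffOn_closure (L : ℝ) :
    ∃ K : ℝ≥0, ∀ φ : EuclideanSpace ℝ (Fin 3) → F,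
      ContDiffOn ℝ ∞ φ (closure (unitCylinder : Set (EuclideanSpace ℝ (Fin 3)))) →
      eSobolevDomainNorm 1 ∞ (cylinderCell L) volume φ ≤
        K * eSobolevDomainNorm 3 2 (cylinderCell L) volume φ := by
  obtain ⟨K, hK⟩ := cylinderCell_eSobolevDomainNorm_one_top_le (F := F) L
  exact ⟨K, fun φ hφ => hK φ (hφ.mono (subset_closure.trans (closure_cylinderCell_subset L)))⟩

end SupBounds

end Literature.Analysis.FluidPDE
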